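import Mathlib
import Summits.NavierStokesRegularity.NavierStokesRegularity.Theorems.FilamentSkeletonRssClause13ModelPieceWindow

/-!
# Clause 13-J/13-R, brick n3 LAYER C (FAR piece, smoothing remainder): `‖K_q∗f‖₂ ≤ (2/q)·5e^{−X/2}·‖f‖₂` when `f̂` lives in `|z|√q ≥ X`

Route `FilamentSkeletonRss`, ∃-side clause 13 (`Clause13RNearStraightL` stmt-NavierStokesRegularity-23612; typing-agnostic); design
`filament-plan/DESIGN-28296-model-gluing-g16.md` §1/§3 (window H) and the v2 addendum §A (FAR piece; task C5).  In the far regime the non-local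
part `K_q∗` of `M_q = (2/q) − K_q∗` is a small remainder: `K̂_q(z) = (2/q)(1 − 𝔖(z√q))` (`fourier_smoothingKernel`) and `0 ≤ 1 − 𝔖(x) ≤ 5e^{−|x|/2}`
(`…Clause13SymbolDecay`), so by Plancherel `‖K_q∗f‖₂ ≤ (2/q)5e^{−X/2}‖f‖₂` for `f̂` supported in `|z|√q ≥ X`; this is the `Rm = −iG·K_q∗Y_H` input of
the far-branch energy estimate `model_farBranch_energy` (p696498).
* §1 `integral_sq_norm_piece_le_of_symbol_bound` — generic: `‖k∗f‖₂ ≤ η‖f‖₂` if `|k̂| ≤ η` on the spectrum of `f` (Plancherel + `(k∗f)^ = k̂·f̂`);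
* §2 `unnormalisedTransform_smoothingKernel`, `norm_transform_smoothingKernel_le`, `integral_sq_norm_smoothingPiece_far_le`.
Lane ns-filament-19175-p1 g16; `--supports stmt-NavierStokesRegularity-23612 --as helper`.
HONEST FRAMING: bookkeeping about an explicit 1-D model operator attached to a HYPOTHETICAL filament skeleton on the NEGATIVE side of a MODEL route;
nothing here bears on Navier–Stokes regularity or blow-up.
-/

noncomputable section

open MeasureTheory Real Complex Filter Set
open scoped ComplexConjugate Topology Convolution FourierTransform
open Summit.NavierStokesRegularity.NavierStokesRegularity.Theorems.AnalyticStripLiaSymbol (liaSym liaSym_neg one_sub_liaSym_nonneg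
  one_sub_liaSym_le_exp)

namespace Summit.NavierStokesRegularity.NavierStokesRegularity.Theorems.MatchedKernel
set_option linter.dupNamespace false

/-! ## §1 A piece is bounded in `L²` by the sup of its symbol on the spectrum -/

/-- **`‖k∗f‖₂ ≤ η‖f‖₂` when `|k̂| ≤ η` on the spectrum of `f`.**  `k` real, continuous, integrable; `f` continuous, bounded, in `L¹ ∩ L²`;
`‖∫k e^{izt}‖ ≤ η` at every `z` where `f̂(z) ≠ 0`.  Then `k∗f ∈ L²` and `∫‖k∗f‖² ≤ η²∫‖f‖²` (Plancherel, `(k∗f)^ = k̂·f̂`). [folklore] -/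
theorem integral_sq_norm_piece_le_of_symbol_bound {k : ℝ → ℝ} (hkc : Continuous k) (hki : Integrable k)
    {f : ℝ → ℂ} (hfc : Continuous f) (hf1 : Integrable f) (hf2 : MemLp f 2) {Mf : ℝ} (hfb : ∀ y, ‖f y‖ ≤ Mf)
    {η : ℝ} (hη : ∀ z : ℝ, (∫ x : ℝ, f x * cexp (I * z * x)) ≠ 0 → ‖∫ t : ℝ, ((k t : ℝ) : ℂ) * cexp (I * z * t)‖ ≤ η) :
    MemLp (fun x : ℝ => ∫ y : ℝ, ((k (x - y) : ℝ) : ℂ) * f y) 2 volume ∧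
      ∫ x : ℝ, ‖∫ y : ℝ, ((k (x - y) : ℝ) : ℂ) * f y‖ ^ 2 ≤ η ^ 2 * ∫ x : ℝ, ‖f x‖ ^ 2 := by
  obtain ⟨hg2, _⟩ := l2_kernel_mul_le hkc hki hfc hf2 hfb
  refine ⟨hg2, ?_⟩
  have hg1 : Integrable (fun x : ℝ => ∫ y : ℝ, ((k (x - y) : ℝ) : ℂ) * f y) := by
    rw [piece_eq_convolution]
    exact hki.ofReal.integrable_convolution _ hf1
  have hπ : 0 < π := Real.pi_pos
  -- Plancherel for the piece and for `f`
  have hplg : ∫ x : ℝ, ‖∫ y : ℝ, ((k (x - y) : ℝ) : ℂ) * f y‖ ^ 2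
      = 1 / (2 * π) * ∫ z : ℝ, ‖∫ x : ℝ, (∫ y : ℝ, ((k (x - y) : ℝ) : ℂ) * f y) * cexp (I * z * x)‖ ^ 2 := by
    rw [← Literature.Analysis.FunctionSpaces.integral_norm_sq_fourierIntegral_eq hg1 hg2, integral_norm_sq_fourier_eq_unnormalised]
  have hplf : ∫ x : ℝ, ‖f x‖ ^ 2 = 1 / (2 * π) * ∫ z : ℝ, ‖∫ x : ℝ, f x * cexp (I * z * x)‖ ^ 2 := by
    rw [← Literature.Analysis.FunctionSpaces.integral_norm_sq_fourierIntegral_eq hf1 hf2, integral_norm_sq_fourier_eq_unnormalised]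
  -- `(k∗f)^ = k̂·f̂` and the pointwise bound
  have hconv : ∀ z : ℝ, ∫ x : ℝ, (∫ y : ℝ, ((k (x - y) : ℝ) : ℂ) * f y) * cexp (I * z * x)
      = (∫ t : ℝ, ((k t : ℝ) : ℂ) * cexp (I * z * t)) * ∫ x : ℝ, f x * cexp (I * z * x) := by
    intro z
    have h := unnormalisedTransform_conv (k := fun t => ((k t : ℝ) : ℂ)) hki.ofReal hf1 z
    beta_reduce at h
    exact h
  have hpt : ∀ z : ℝ, ‖∫ x : ℝ, (∫ y : ℝ, ((k (x - y) : ℝ) : ℂ) * f y) * cexp (I * z * x)‖ ^ 2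
      ≤ η ^ 2 * ‖∫ x : ℝ, f x * cexp (I * z * x)‖ ^ 2 := by
    intro z
    rw [hconv z, norm_mul, mul_pow]
    by_cases h0 : (∫ x : ℝ, f x * cexp (I * z * x)) = 0
    · rw [h0]; simp
    · exact mul_le_mul_of_nonneg_right (pow_le_pow_left₀ (norm_nonneg _) (hη z h0) 2) (by positivity)
  have hFi := integrable_norm_sq_unnormalisedTransform hf1 hf2
  have hle : ∫ z : ℝ, ‖∫ x : ℝ, (∫ y : ℝ, ((k (x - y) : ℝ) : ℂ) * f y) * cexp (I * z * x)‖ ^ 2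
      ≤ η ^ 2 * ∫ z : ℝ, ‖∫ x : ℝ, f x * cexp (I * z * x)‖ ^ 2 := by
    rw [← integral_const_mul]
    exact integral_mono_of_nonneg (ae_of_all _ fun z => by positivity) (hFi.const_mul _) (ae_of_all _ hpt)
  rw [hplg, hplf]
  calc 1 / (2 * π) * ∫ z : ℝ, ‖∫ x : ℝ, (∫ y : ℝ, ((k (x - y) : ℝ) : ℂ) * f y) * cexp (I * z * x)‖ ^ 2
      ≤ 1 / (2 * π) * (η ^ 2 * ∫ z : ℝ, ‖∫ x : ℝ, f x * cexp (I * z * x)‖ ^ 2) := mul_le_mul_of_nonneg_left hle (by positivity)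
    _ = η ^ 2 * (1 / (2 * π) * ∫ z : ℝ, ‖∫ x : ℝ, f x * cexp (I * z * x)‖ ^ 2) := by ring

/-! ## §2 The smoothing kernel in the far regime -/

/-- **`∫K_q(t)e^{izt}dt = (2/q)(1 − 𝔖(z√q))`** (`fourier_smoothingKernel` in the un-normalised convention; `𝔖` is even). [folklore] -/
theorem unnormalisedTransform_smoothingKernel {q : ℝ} (hq : 0 < q) (z : ℝ) :
    ∫ t : ℝ, ((((2 * q - t ^ 2) * ((t ^ 2 + q) ^ (5 / 2 : ℝ))⁻¹ : ℝ)) : ℂ) * cexp (I * z * t)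
      = (((2 / q * (1 - liaSym (z * √q))) : ℝ) : ℂ) := by
  rw [unnormalisedTransform_eq_fourier (fun t : ℝ => ((((2 * q - t ^ 2) * ((t ^ 2 + q) ^ (5 / 2 : ℝ))⁻¹ : ℝ)) : ℂ)) z,
    fourier_smoothingKernel hq]
  rw [show 2 * π * (-z / (2 * π)) * √q = -(z * √q) by field_simp, liaSym_neg]

/-- **`|K̂_q(z)| ≤ (2/q)·5e^{−X/2}`** for `0 < X ≤ |z|√q`. [folklore] -/
theorem norm_transform_smoothingKernel_le {q X : ℝ} (hq : 0 < q) (hX : 0 < X) {z : ℝ} (hz : X ≤ |z| * √q) :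
    ‖∫ t : ℝ, ((((2 * q - t ^ 2) * ((t ^ 2 + q) ^ (5 / 2 : ℝ))⁻¹ : ℝ)) : ℂ) * cexp (I * z * t)‖
      ≤ 2 / q * (5 * Real.exp (-(X / 2))) := by
  rw [unnormalisedTransform_smoothingKernel hq z, Complex.norm_real, Real.norm_eq_abs,
    abs_of_nonneg (mul_nonneg (by positivity) (one_sub_liaSym_nonneg _))]
  refine mul_le_mul_of_nonneg_left ?_ (by positivity)
  have h1 : liaSym (z * √q) = liaSym (|z| * √q) := by
    rcases le_or_gt 0 z with h | h
    · rw [abs_of_nonneg h]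
    · rw [abs_of_neg h, neg_mul, liaSym_neg]
  rw [h1]
  have hpos : 0 < |z| * √q := lt_of_lt_of_le hX hz
  refine (one_sub_liaSym_le_exp _ hpos).trans ?_
  exact mul_le_mul_of_nonneg_left (Real.exp_le_exp.2 (by linarith)) (by norm_num)

/-- **FAR SMOOTHING REMAINDER.**  `q, X > 0`; `f` continuous, bounded, in `L¹ ∩ L²`, with `f̂ = 0` on `|z|√q < X`.  Then `K_q∗f ∈ L²` and
`∫‖K_q∗f‖² ≤ ((2/q)·5e^{−X/2})²·∫‖f‖²`. [folklore] -/
theorem integral_sq_norm_smoothingPiece_far_le {q X : ℝ} (hq : 0 < q) (hX : 0 < X) {f : ℝ → ℂ} (hfc : Continuous f)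
    (hf1 : Integrable f) (hf2 : MemLp f 2) {Mf : ℝ} (hfb : ∀ y, ‖f y‖ ≤ Mf)
    (hsupp : ∀ z : ℝ, |z| * √q < X → ∫ x : ℝ, f x * cexp (I * z * x) = 0) :
    MemLp (fun x : ℝ => ∫ y : ℝ, ((((2 * q - (x - y) ^ 2) * (((x - y) ^ 2 + q) ^ (5 / 2 : ℝ))⁻¹ : ℝ)) : ℂ) * f y) 2 volume ∧
      ∫ x : ℝ, ‖∫ y : ℝ, ((((2 * q - (x - y) ^ 2) * (((x - y) ^ 2 + q) ^ (5 / 2 : ℝ))⁻¹ : ℝ)) : ℂ) * f y‖ ^ 2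
        ≤ (2 / q * (5 * Real.exp (-(X / 2)))) ^ 2 * ∫ x : ℝ, ‖f x‖ ^ 2 := by
  have hη : ∀ z : ℝ, (∫ x : ℝ, f x * cexp (I * z * x)) ≠ 0 →
      ‖∫ t : ℝ, ((((2 * q - t ^ 2) * ((t ^ 2 + q) ^ (5 / 2 : ℝ))⁻¹ : ℝ)) : ℂ) * cexp (I * z * t)‖ ≤ 2 / q * (5 * Real.exp (-(X / 2))) := by
    intro z hz
    have hz' : X ≤ |z| * √q := by
      by_contra h'
      exact hz (hsupp z (not_le.1 h'))
    exact norm_transform_smoothingKernel_le hq hX hz'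
  exact integral_sq_norm_piece_le_of_symbol_bound (k := fun s : ℝ => (2 * q - s ^ 2) * ((s ^ 2 + q) ^ (5 / 2 : ℝ))⁻¹)
    (continuous_smoothingKernel hq) (integrable_smoothingKernel_real hq) hfc hf1 hf2 hfb hη

end Summit.NavierStokesRegularity.NavierStokesRegularity.Theorems.MatchedKernel

end
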